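import Summits.MatrixMultiplication.OmegaCensus.STPPKill223332332Z46Reduce
import Summits.MatrixMultiplication.OmegaCensus.STPPCosetQuotientKillN46B

/-!
# ω-census (abelian STPP census): `{(2,2,3),(3,3,2),(3,3,2)}` has no STPP realisation in any abelian group of order `46`; **ORDER 46 UNCONDITIONAL** (kernel)

HONEST FRAMING (pub-omega census; verbatim): lottery ticket; floor = certified bounds/negative ranges.
Census EXCLUSION (seat pub-omega-stpp-2 gen 32, 2026-08-30), family (b2).  Finale of HOME `pub-omega-stpp-2-g32/CASEMAP.md`.
* `branchII_dead`: the last branch — `C_j = {c, c + 23}` a `K`-coset — is empty: by `blockB_structure i` either `Z°_i = ⋃_{k≠i}(C_k − A_k)` is a `12`-progression of a step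
  `e′` with `2e′ ≠ 0`, but it contains `c − a` and `(c + 23) − a` (`a ∈ A_j`), two elements differing by `23` (`not_mem_vadd23_of_apFinset`); or `B_i ⊇ {b, b + 23}`, and then
  `Y_i = C_i − B_i` puts a `23`-pair inside the `12`-progression `Y°_j` (step `d_j`, `2d_j ≠ 0`) of `A_j`'s structure — impossible again.
* `no_isSTPP_zmod46_223_332_332` (`reduce_to_branchII` + `branchII_dead`; Branch I is `no_allAP_223_332_332`), transported to every abelian group of order `46`
  (`exists_family_zmod46`): `no_isSTPP_card46_223_332_332`, `notRealizable_card46_223_332_332`.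
* **`KLister.volume_le_of_card_eq_46`: every abelian group of order `46` admits no beating STPP family — KERNEL, UNCONDITIONAL** (the g31 capstone
  `volume_le_of_card_eq_46_of_not_realizable_223_332_332` with its hypothesis discharged).  With the tree's capstones this makes every abelian group of
  order `≤ 41`, `43`, `46`, `47`, `59`, `61` unconditional (orders `42`, `44`, `45` remain conditional on their residual 2-block patterns).
Only CKSU Def. 5.1, Kneser's theorem and Kemperman's Theorem 2.1 (tree) enter, plus kernel decisions over `ℤ/46ℤ` indices.  Nothing here is progress on `ω`:
the theorem EXCLUDES beating STPP families in the (unique) abelian group of order `46`.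

References: H. Cohn, R. Kleinberg, B. Szegedy, C. Umans, FOCS 2005 (arXiv:math/0511460), Def. 5.1, Thm. 5.5; M. Kneser, Math. Z. 58 (1953); J. H. B. Kemperman, Acta Math.
103 (1960), Thm 2.1.
-/

open Finset
open scoped Pointwise

namespace Summit.MatrixMultiplication.OmegaCensus.Z46

open Literature.Computability.AlgebraicComplexity
open Literature.Combinatorics.Additive
open Summit.MatrixMultiplication.OmegaCensus.STPPKneser
open Summit.MatrixMultiplication.OmegaCensus.CubeNB

variable {A B C : Fin 3 → Finset (ZMod 46)}

/-- A `12`-term progression of step `d` with `2d ≠ 0` contains no `x, x + 23`. [folklore] -/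
theorem not_mem_vadd23_of_apFinset12 {s d x : ZMod 46} (hd : 2 • d ≠ 0) (hx : x ∈ apFinset s d 12) (hx' : x + 23 ∈ apFinset s d 12) : False := by
  have hsub : apFinset s d 12 ⊆ apFinset s d 13 := by rw [apFinset_add_eq_union s d 12 1]; exact Finset.subset_union_left
  exact not_mem_vadd23_of_apFinset hd (hsub hx) (hsub hx')

/-- **BRANCH II is empty** (in the form required by `reduce_to_branchII`). [cite: CohnKleinbergSzegedyUmans2005, Def. 5.1] [cite: Kemperman1960, Thm 2.1] [cite: Kneser1953] -/
theorem branchII_dead (hS : IsSTPP A B C) (hA : ∀ i, #(A i) = ![2, 3, 3] i) (hB : ∀ i, #(B i) = ![2, 3, 3] i)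
    (hC : ∀ i, #(C i) = ![3, 2, 2] i) :
    ∀ i j : Fin 3, i ≠ 0 → j ≠ 0 → i ≠ j → (∃ c : ZMod 46, C j = {c, c + 23}) →
      (∃ δ : ZMod 46, 2 • δ ≠ 0 ∧ IsAP (C i) δ ∧ IsAP (DU A B (univ.erase i)) δ) →
      (∃ d : ZMod 46, 2 • d ≠ 0 ∧ IsAP (A j) d ∧ IsAP (DU B C (univ.erase j)) d) →
      (∃ e : ZMod 46, 2 • e ≠ 0 ∧ IsAP (B j) e ∧ IsAP (DU A C (univ.erase j)) e) →
      ((∃ d : ZMod 46, 2 • d ≠ 0 ∧ IsAP (A i) d ∧ IsAP (DU B C (univ.erase i)) d) ∨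
        ((23 : ZMod 46) +ᵥ DU B C (univ.erase i) = DU B C (univ.erase i) ∧ ∃ a ∈ A i, a + 23 ∈ A i)) →
      ((∃ e : ZMod 46, 2 • e ≠ 0 ∧ IsAP (B i) e ∧ IsAP (DU A C (univ.erase i)) e) ∨
        ((23 : ZMod 46) +ᵥ DU A C (univ.erase i) = DU A C (univ.erase i) ∧ ∃ b ∈ B i, b + 23 ∈ B i)) → False := by
  intro i j hi hj hij hCj _ hAj _ _ sBi
  have hAne : ∀ i, (A i).Nonempty := fun i => card_pos.1 (by rw [hA]; fin_cases i <;> simp)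
  have hBne : ∀ i, (B i).Nonempty := fun i => card_pos.1 (by rw [hB]; fin_cases i <;> simp)
  have hCne : ∀ i, (C i).Nonempty := fun i => card_pos.1 (by rw [hC]; fin_cases i <;> simp)
  obtain ⟨c, hc⟩ := hCj
  obtain ⟨d, hd, -, hTj⟩ := hAj
  have hcj : c ∈ C j := by rw [hc]; simp
  have hcj' : c + 23 ∈ C j := by rw [hc]; simp
  have hjI : j ∈ univ.erase i := Finset.mem_erase.2 ⟨hij.symm, Finset.mem_univ _⟩
  have hiJ : i ∈ univ.erase j := Finset.mem_erase.2 ⟨hij, Finset.mem_univ _⟩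
  rcases sBi with ⟨e', he', -, hRi⟩ | ⟨-, b, hb, hb'⟩
  · -- `Z_j ⊆ Z°_i`, a 12-progression of step `e'`, contains `c − a` and `c − a + 23`
    obtain ⟨r, hr⟩ := hRi
    have h12 : #(DU A C (univ.erase i)) = 12 := by
      rw [card_DU_AC hS hBne]; fin_cases i <;> simp at hi ⊢ <;> simp only [hA, hC] <;> decide
    rw [h12] at hr
    obtain ⟨a, ha⟩ := hAne j
    have hx : c - a ∈ DU A C (univ.erase i) := Finset.mem_biUnion.2 ⟨j, hjI, mem_D.2 ⟨a, ha, c, hcj, rfl⟩⟩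
    have hx' : c - a + 23 ∈ DU A C (univ.erase i) :=
      Finset.mem_biUnion.2 ⟨j, hjI, mem_D.2 ⟨a, ha, c + 23, hcj', by abel⟩⟩
    rw [hr] at hx hx'
    exact not_mem_vadd23_of_apFinset12 he' hx hx'
  · -- `B_i ⊇ {b, b + 23}`: `Y_i ⊆ Y°_j`, a 12-progression of step `d`, contains `c' − (b + 23)` and `c' − b`
    obtain ⟨t, ht⟩ := hTj
    have h12 : #(DU B C (univ.erase j)) = 12 := by
      rw [card_DU_BC hS hAne]; fin_cases j <;> simp at hj ⊢ <;> simp only [hB, hC] <;> decide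
    rw [h12] at ht
    obtain ⟨c', hc'⟩ := hCne i
    have hy : c' - (b + 23) ∈ DU B C (univ.erase j) := Finset.mem_biUnion.2 ⟨i, hiJ, mem_D.2 ⟨b + 23, hb', c', hc', rfl⟩⟩
    have hy' : c' - (b + 23) + 23 ∈ DU B C (univ.erase j) :=
      Finset.mem_biUnion.2 ⟨i, hiJ, mem_D.2 ⟨b, hb, c', hc', by abel⟩⟩
    rw [ht] at hy hy'
    exact not_mem_vadd23_of_apFinset12 hd hy hy'

/-- **`{(2,2,3),(3,3,2),(3,3,2)}` has no STPP family in `ℤ/46ℤ`.** [cite: CohnKleinbergSzegedyUmans2005, Def. 5.1] [cite: Kemperman1960, Thm 2.1] [cite: Kneser1953] -/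
theorem no_isSTPP_zmod46_223_332_332 (A B C : Fin 3 → Finset (ZMod 46)) (hS : IsSTPP A B C) (hA : ∀ i, #(A i) = ![2, 3, 3] i)
    (hB : ∀ i, #(B i) = ![2, 3, 3] i) (hC : ∀ i, #(C i) = ![3, 2, 2] i) : False :=
  reduce_to_branchII hS hA hB hC (branchII_dead hS hA hB hC)

/-- **`{(2,2,3),(3,3,2),(3,3,2)}` has no STPP family in any abelian group of order `46`.** [cite: CohnKleinbergSzegedyUmans2005, Def. 5.1] -/
theorem no_isSTPP_card46_223_332_332 {H : Type*} [AddCommGroup H] [Fintype H] [DecidableEq H] (hH : Fintype.card H = 46)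
    (A B C : Fin 3 → Finset H) (hS : IsSTPP A B C) (hA : ∀ i, #(A i) = ![2, 3, 3] i) (hB : ∀ i, #(B i) = ![2, 3, 3] i)
    (hC : ∀ i, #(C i) = ![3, 2, 2] i) : False := by
  obtain ⟨A', B', C', hS', hc⟩ := exists_family_zmod46 hH A B C hS
  exact no_isSTPP_zmod46_223_332_332 A' B' C' hS' (fun i => by rw [(hc i).1, hA]) (fun i => by rw [(hc i).2.1, hB])
    (fun i => by rw [(hc i).2.2, hC])

end Summit.MatrixMultiplication.OmegaCensus.Z46

namespace Summit.MatrixMultiplication.OmegaCensus.KLister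

open Literature.Computability.AlgebraicComplexity
open Summit.MatrixMultiplication.OmegaCensus.Z46

/-- `223_332_332` is not realisable in any abelian group of order `46`. [cite: CohnKleinbergSzegedyUmans2005, Def. 5.1] -/
theorem notRealizable_card46_223_332_332 {H : Type*} [AddCommGroup H] [Fintype H] [DecidableEq H] (hH : Fintype.card H = 46) :
    ¬ Realizable H ([(2, 2, 3), (3, 3, 2), (3, 3, 2)] : List Shape) := by
  intro h
  obtain ⟨A, B, C, hS, hc⟩ := h.out
  exact no_isSTPP_card46_223_332_332 hH A B C hS (fun i => by fin_cases i <;> exact (hc _).2.2.2.1)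
    (fun i => by fin_cases i <;> exact (hc _).2.2.2.2.1) (fun i => by fin_cases i <;> exact (hc _).2.2.2.2.2)

/-- **Every abelian group of order `46` admits no beating STPP family — KERNEL, UNCONDITIONAL:** for every finite abelian group `H` with `|H| = 46`, every `m`
and every STPP family `(Aᵢ, Bᵢ, Cᵢ)_{i<m}` (CKSU Def. 5.1), `Σᵢ |Aᵢ||Bᵢ||Cᵢ| ≤ 46`. [cite: CohnKleinbergSzegedyUmans2005, Def. 5.1, Thm. 5.5] -/
theorem volume_le_of_card_eq_46 {H : Type*} [AddCommGroup H] [Fintype H] [DecidableEq H] (hH : Fintype.card H = 46)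
    {m : ℕ} (A B C : Fin m → Finset H) (hS : IsSTPP A B C) : ∑ i, #(A i) * #(B i) * #(C i) ≤ 46 :=
  volume_le_of_card_eq_46_of_not_realizable_223_332_332 hH (notRealizable_card46_223_332_332 hH) A B C hS

end Summit.MatrixMultiplication.OmegaCensus.KLister
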